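import Literature.AlgebraicGeometry.HodgeTheory.FermatEigenspaceNonvanishing
import Literature.AlgebraicGeometry.HodgeTheory.FermatInvariantClassesAmbient
import Literature.AlgebraicTopology.SingularHomology.BettiNumberBaseChange
import HarnessLib

/-!
# The middle Betti number of the even-dimensional Fermat variety: `b₂ᵣ(X²ʳₘ) = #𝔄²ʳₘ + 1`; the Fermat surface `b₂(X²ₘ) = m³ − 4m² + 6m − 2`
# (Shioda 1979 §1 (1.3)–(1.4); Ran 1980 Prop. 1.7 (i))

Family `hodge`, layer `Literature/AlgebraicGeometry/HodgeTheory`. PROOF FILE (theorems only: no definition, no named fact,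
no instance; D-0026 net debt `0`). T. Shioda, *The Hodge conjecture for Fermat varieties*, Math. Ann. 245 (1979), §1
(1.3)–(1.4): "`Hⁿ_prim(Xⁿₘ, ℂ) = ⊕_{α ∈ 𝔄ⁿₘ} V(α)`, `dim V(α) = 1`", `𝔄ⁿₘ = {(a₀, …, aₙ₊₁) : aᵢ ∈ ℤ/m ∖ 0, Σ aᵢ = 0}`, whence
for `n` even `bₙ(Xⁿₘ) = |𝔄ⁿₘ| + 1` (the extra `1` is the class `hⁿᐟ²` of the ambient projective space). Z. Ran, *Cycles on
Fermat hypersurfaces*, Compositio Math. 42 (1980), §1 Prop. 1.7 (i). For the Fermat SURFACE `X²ₘ ⊂ ℙ³`: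
`|𝔄²ₘ| = #{(a₀, …, a₃) ∈ (ℤ/m ∖ 0)⁴ : Σ aᵢ = 0} = (m − 1)(m² − 3m + 3)` and `b₂(X²ₘ) = m³ − 4m² + 6m − 2` — the value
of D. Eisenbud, J. Harris, *3264 and All That* (2016), Example 5.24 / Table 5.1 (`b₂` of a smooth surface of degree `d`
in `ℙ³` is `d³ − 4d² + 6d − 2`) at the Fermat surface.

Everything is ASSEMBLED from tree theorems (nothing cited is used as a hypothesis): the character decomposition
`H²ʳ(X²ʳₘ(ℂ); ℂ) = ⊕_α V(α)` (`isInternal_fermatEigenspace`), `V(α) = 0` unless `Σ αᵢ = 0`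
(`fermatEigenspace_eq_bot_of_sum_ne_zero`) and unless `α = 0` or all `αᵢ ≠ 0` (`fermatEigenspace_eq_bot_of_apply_eq_zero`),
`dim V(α) ≤ 1` for `α ≠ 0` (`fermatEigenspace_le_span_of_ne_zero`, Pham–Brieskorn), `V(α) ≠ 0` on `𝔄²ʳₘ`
(`fermatEigenspace_ne_bot`), `dim V(0) ≤ 1` (`finrank_fermatEigenspace_zero_le_one`) and `V(0) ∋ ι^*h^r ≠ 0`
(`exists_map_hypersurfaceι_ne_zero`, `map_diagonalMap_map_hypersurfaceι`).

* `card_fermatAdmissible_succ_add` — the character count `N_{k+1} + N_k = (m − 1)^k`,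
  `N_k = #{α ∈ (ℤ/m ∖ 0)^k : Σ αᵢ = 0}` (drop the last coordinate); `card_fermatAdmissible_four_add`
  (`N₄ + (m−1)² = (m−1)³ + (m−1)`; the small counts `N₁ = 0`, `N₂ = m − 1`, `N₃` are private).
* `finrank_fermatEigenspace_eq_one_of_forall_ne_zero`, `finrank_fermatEigenspace_zero_eq_one`,
  `finrank_fermatEigenspace_eq_zero_of_not` — the three cases `dim V(α) ∈ {1, 1, 0}`.
* **`finrank_complexBetti_fermat_even_eq_card_add_one`** — `b₂ᵣ(X²ʳₘ) = |𝔄²ʳₘ| + 1` (`r, m ≥ 1`).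
* **`finrank_complexBetti_fermatSurface_two`**, **`finrank_bettiCohomology_fermatSurface_two`** — `b₂(X²ₘ) = m³ + 6m − (4m² + 2)`
  over `ℂ` and over `ℚ` (`m ≥ 1`; written without truncated subtraction issues since `m³ + 6m ≥ 4m² + 2` for `m ≥ 1`).

Written by the prover seat `hodge-nonav-prover-Bx` (g10) as the Fermat anchor of the discharge of the named fact
`EisenbudHarris2016_surface_secondBettiNumber` (K1-A binder B2 of route `HodgeConjecture/CyclicUnitaryPowers`).

## References

* [Shioda1979HodgeFermat] T. Shioda, The Hodge conjecture for Fermat varieties, Math. Ann. 245 (1979) 175–184, §1 (1.3)–(1.4).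
* [Ran1980] Z. Ran, Cycles on Fermat hypersurfaces, Compositio Math. 42 (1980) 121–142, §1 Prop. 1.7 (i).
* [EisenbudHarris2016] D. Eisenbud, J. Harris, 3264 and All That, CUP 2016, §5.7 Example 5.24 and Table 5.1.
-/

noncomputable section

open CategoryTheory AlgebraicGeometry

namespace Literature.AlgebraicGeometry.HodgeTheory

open Literature.AlgebraicGeometry.Motives Literature.AlgebraicTopology.SingularHomology

/-! ### The character count `N_k = #{α ∈ (ℤ/m ∖ 0)^k : Σ αᵢ = 0}` -/

section Count

variable (m : ℕ)

/-- `#{a ∈ ℤ/m : a ≠ 0} = m − 1` (`m ≥ 1`). [folklore] -/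
private theorem card_zmod_ne_zero [NeZero m] : Fintype.card {a : ZMod m // a ≠ 0} = m - 1 := by
  rw [Fintype.card_subtype_compl, Fintype.card_subtype_eq, ZMod.card]

/-- `#{α ∈ (ℤ/m)^k : all αᵢ ≠ 0} = (m − 1)^k`. [folklore] -/
private theorem card_forall_ne_zero [NeZero m] (k : ℕ) :
    Fintype.card {α : Fin k → ZMod m // ∀ i, α i ≠ 0} = (m - 1) ^ k := by
  rw [Fintype.card_congr (Equiv.subtypePiEquivPi (p := fun (_ : Fin k) (a : ZMod m) ↦ a ≠ 0)),
    Fintype.card_pi, Finset.prod_const, Finset.card_univ, Fintype.card_fin, card_zmod_ne_zero]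

/-- **The recursion `N_{k+1} + N_k = (m − 1)^k`** for `N_k = #{α ∈ (ℤ/m ∖ 0)^k : Σ αᵢ = 0}`: dropping the last coordinate
identifies the admissible `(k+1)`-tuples with the nowhere-zero `k`-tuples of NON-zero sum (the last coordinate is minus that
sum), and these together with the admissible `k`-tuples are all nowhere-zero `k`-tuples.
[cite: Shioda1979HodgeFermat, §1 (1.3)–(1.4)] -/
theorem card_fermatAdmissible_succ_add [NeZero m] (k : ℕ) :
    Fintype.card {α : Fin (k + 1) → ZMod m // (∀ i, α i ≠ 0) ∧ ∑ i, α i = 0} +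
      Fintype.card {α : Fin k → ZMod m // (∀ i, α i ≠ 0) ∧ ∑ i, α i = 0} = (m - 1) ^ k := by
  classical
  -- admissible `(k+1)`-tuples ≃ nowhere-zero `k`-tuples with non-zero sum
  have e : {α : Fin (k + 1) → ZMod m // (∀ i, α i ≠ 0) ∧ ∑ i, α i = 0} ≃
      {β : Fin k → ZMod m // (∀ i, β i ≠ 0) ∧ ∑ i, β i ≠ 0} :=
    { toFun := fun α ↦ ⟨Fin.init α.1, fun i ↦ α.2.1 (Fin.castSucc i), by
        have h := α.2.2
        rw [Fin.sum_univ_castSucc] at h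
        intro h0
        have : α.1 (Fin.last k) = 0 := by
          have : ∑ i : Fin k, Fin.init α.1 i = ∑ i : Fin k, α.1 (Fin.castSucc i) := rfl
          rw [← this, h0, zero_add] at h
          exact h
        exact α.2.1 (Fin.last k) this⟩
      invFun := fun β ↦ ⟨Fin.snoc β.1 (-∑ i, β.1 i), by
        refine ⟨fun i ↦ ?_, ?_⟩
        · refine Fin.lastCases ?_ (fun j ↦ ?_) i
          · rw [Fin.snoc_last]
            exact neg_ne_zero.mpr β.2.2
          · rw [Fin.snoc_castSucc]
            exact β.2.1 j
        · rw [Fin.sum_univ_castSucc]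
          simp only [Fin.snoc_castSucc, Fin.snoc_last, add_neg_cancel]⟩
      left_inv := fun α ↦ by
        apply Subtype.ext
        have h := α.2.2
        rw [Fin.sum_univ_castSucc] at h
        have hlast : α.1 (Fin.last k) = -∑ i : Fin k, α.1 (Fin.castSucc i) := eq_neg_of_add_eq_zero_right h
        ext i
        refine Fin.lastCases ?_ (fun j ↦ ?_) i
        · simp only [Fin.snoc_last, hlast]
          rfl
        · simp only [Fin.snoc_castSucc]
          rfl
      right_inv := fun β ↦ by
        apply Subtype.ext
        ext i
        simp only [Fin.init_snoc] }
  rw [Fintype.card_congr e]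
  -- nowhere-zero `k`-tuples split by `Σ βᵢ ≠ 0` / `= 0`
  have hsplit : Fintype.card {β : Fin k → ZMod m // (∀ i, β i ≠ 0) ∧ ∑ i, β i ≠ 0} +
      Fintype.card {β : Fin k → ZMod m // (∀ i, β i ≠ 0) ∧ ∑ i, β i = 0} =
      Fintype.card {β : Fin k → ZMod m // ∀ i, β i ≠ 0} := by
    rw [Fintype.card_subtype, Fintype.card_subtype, Fintype.card_subtype]
    rw [← Finset.card_union_of_disjoint]
    · congr 1
      ext β
      simp only [Finset.mem_union, Finset.mem_filter, Finset.mem_univ, true_and]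
      tauto
    · rw [Finset.disjoint_filter]
      intro β _ h1 h2
      exact h1.2 h2.2
  rw [hsplit, card_forall_ne_zero]

/-- `N₁ = 0`: a single non-zero coordinate does not sum to zero. [folklore] -/
private theorem card_fermatAdmissible_one [NeZero m] :
    Fintype.card {α : Fin 1 → ZMod m // (∀ i, α i ≠ 0) ∧ ∑ i, α i = 0} = 0 := by
  rw [Fintype.card_eq_zero_iff]
  refine ⟨fun α ↦ ?_⟩
  have h := α.2.2
  rw [Fin.sum_univ_one] at h
  exact α.2.1 0 h

/-- `N₂ = m − 1` (the pairs `(a, −a)`, `a ≠ 0`). [folklore] -/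
private theorem card_fermatAdmissible_two [NeZero m] :
    Fintype.card {α : Fin 2 → ZMod m // (∀ i, α i ≠ 0) ∧ ∑ i, α i = 0} = m - 1 := by
  have h := card_fermatAdmissible_succ_add m 1
  rw [card_fermatAdmissible_one, add_zero, pow_one] at h
  exact h

/-- `N₃ + (m − 1) = (m − 1)²`. [folklore] -/
private theorem card_fermatAdmissible_three_add [NeZero m] :
    Fintype.card {α : Fin 3 → ZMod m // (∀ i, α i ≠ 0) ∧ ∑ i, α i = 0} + (m - 1) = (m - 1) ^ 2 := by
  have h := card_fermatAdmissible_succ_add m 2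
  rw [card_fermatAdmissible_two] at h
  exact h

/-- **`N₄ + (m − 1)² = (m − 1)³ + (m − 1)`**, i.e. `N₄ = (m − 1)(m² − 3m + 3) = m³ − 4m² + 6m − 3` — the number of
admissible characters of the Fermat surface `X²ₘ`. [cite: Shioda1979HodgeFermat, §1 (1.3)–(1.4)] -/
theorem card_fermatAdmissible_four_add [NeZero m] :
    Fintype.card {α : Fin 4 → ZMod m // (∀ i, α i ≠ 0) ∧ ∑ i, α i = 0} + (m - 1) ^ 2 =
      (m - 1) ^ 3 + (m - 1) := by
  have h4 : Fintype.card {α : Fin 4 → ZMod m // (∀ i, α i ≠ 0) ∧ ∑ i, α i = 0} +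
      Fintype.card {α : Fin 3 → ZMod m // (∀ i, α i ≠ 0) ∧ ∑ i, α i = 0} = (m - 1) ^ 3 :=
    card_fermatAdmissible_succ_add m 3
  have h3 := card_fermatAdmissible_three_add m
  omega

end Count

/-! ### The dimensions of the eigenspaces `V(α) ⊆ H²ʳ(X²ʳₘ(ℂ); ℂ)` -/

section Fermat

variable {m : ℕ}

/-- `dim (⨆ᵢ Aᵢ) = Σᵢ dim Aᵢ` for an independent finite family of subspaces (through `⨁ᵢ Aᵢ ≃ ⨆ᵢ Aᵢ`; plumbing).
[folklore] -/
private theorem finrank_iSup_eq_sum_of_iSupIndep {K M : Type*} [Field K] [AddCommGroup M] [Module K M]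
    {ι : Type*} [Fintype ι] (B : ι → Submodule K M) (hB : iSupIndep B) [∀ i, Module.Finite K (B i)] :
    Module.finrank K ↥(⨆ i, B i) = ∑ i, Module.finrank K (B i) := by
  classical
  have hinj := hB.dfinsupp_lsum_injective
  have hrange : LinearMap.range (DFinsupp.lsum ℕ (M := fun i => ↥(B i)) fun i => (B i).subtype) = ⨆ i, B i :=
    (Submodule.iSup_eq_range_dfinsupp_lsum B).symm
  rw [← hrange, LinearMap.finrank_range_of_inj hinj, ← Module.finrank_directSum]
  rfl

/-- **`dim V(α) = 1` for an admissible character** `α` (all `αᵢ ≠ 0`, `Σ αᵢ = 0`) of the even-dimensional Fermat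
variety `X²ʳₘ` (`r, m ≥ 1`): at most a line by multiplicity one on the Pham–Brieskorn join
(`fermatEigenspace_le_span_of_ne_zero`), non-zero by `fermatEigenspace_ne_bot`.
[cite: Shioda1979HodgeFermat, §1 (1.3)–(1.4)] [cite: Ran1980, §1 Prop. 1.7 (i)] -/
theorem finrank_fermatEigenspace_eq_one_of_forall_ne_zero [NeZero m] {r : ℕ} (hr : 1 ≤ r)
    {α : Fin (2 * r + 2) → ZMod m} (hα : ∀ i, α i ≠ 0) (hαs : ∑ i, α i = 0) :
    Module.finrank ℂ ↥(fermatEigenspace m α (2 * r)) = 1 := by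
  have hX : IsSmoothProjective (2 * r) (fermatHypersurface (2 * r) m) :=
    isSmoothProjective_fermatHypersurface (by omega) NeZero.one_le
  haveI := finite_complexBetti hX (2 * r)
  have hα0 : α ≠ 0 := fun h ↦ hα 0 (by rw [h]; rfl)
  obtain ⟨v, hv⟩ := fermatEigenspace_le_span_of_ne_zero (NeZero.ne m) hr 0 hα0
  refine le_antisymm ?_ ?_
  · calc Module.finrank ℂ ↥(fermatEigenspace m α (2 * r))
        ≤ Module.finrank ℂ ↥(ℂ ∙ v) := Submodule.finrank_mono hv
      _ ≤ ({v} : Set (complexBetti (fermatHypersurface (2 * r) m) (2 * r))).toFinset.card := finrank_span_le_card _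
      _ = 1 := by simp
  · rw [Nat.one_le_iff_ne_zero, Ne, Submodule.finrank_eq_zero]
    exact fermatEigenspace_ne_bot hr hα hαs

/-- **`dim V(0) = 1`**: the invariant classes of `H²ʳ(X²ʳₘ(ℂ); ℂ)` form the line of ambient classes (`r, m ≥ 1`):
at most a line by `finrank_fermatEigenspace_zero_le_one`, and the restriction `ι^*γ ≠ 0` of a generator of
`H²ʳ(ℙ²ʳ⁺¹(ℂ); ℂ)` is a non-zero invariant class (`exists_map_hypersurfaceι_ne_zero`, `map_diagonalMap_map_hypersurfaceι`).
[cite: Shioda1979HodgeFermat, §1 (1.3)–(1.4)] [cite: Shioda1979PJA, §4] -/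
theorem finrank_fermatEigenspace_zero_eq_one (hm : 1 ≤ m) {r : ℕ} (hr : 1 ≤ r) :
    Module.finrank ℂ ↥(fermatEigenspace m (0 : Fin (2 * r + 2) → ZMod m) (2 * r)) = 1 := by
  obtain ⟨s, rfl⟩ : ∃ s, r = s + 1 := ⟨r - 1, by omega⟩
  have hX : IsSmoothProjective (2 * (s + 1)) (fermatHypersurface (2 * (s + 1)) m) :=
    isSmoothProjective_fermatHypersurface (by omega) hm
  haveI := finite_complexBetti hX (2 * (s + 1))
  refine le_antisymm (finrank_fermatEigenspace_zero_le_one hm (by omega)) ?_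
  rw [Nat.one_le_iff_ne_zero, Ne, Submodule.finrank_eq_zero, Submodule.eq_bot_iff]
  push Not
  -- a non-zero ambient class `ι^* γ`, `γ ∈ H^{2s+2}(ℙ^{2s+3}(ℂ))`
  obtain ⟨γ, hγ⟩ := exists_map_hypersurfaceι_ne_zero (n := 2 * s + 1) (m := m) (by omega) hm (p := s) (by omega)
  refine ⟨complexBetti.map (SmoothHypersurface.hypersurfaceι (fermatPolynomial ℂ (2 * s + 1 + 1) m)) (2 * s + 2) γ,
    ?_, hγ⟩
  show complexBetti.map (SmoothHypersurface.hypersurfaceι (fermatPolynomial ℂ (2 * s + 1 + 1) m)) (2 * s + 2) γ ∈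
    fermatEigenspace m (0 : Fin (2 * s + 1 + 1 + 2) → ZMod m) (2 * s + 2)
  rw [mem_fermatEigenspace_iff]
  intro a
  have h1 : fermatCharacter m (0 : Fin (2 * s + 1 + 1 + 2) → ZMod m) a = 1 := by
    simp [fermatCharacter_apply]
  rw [map_diagonalMap_map_hypersurfaceι, h1, Units.val_one, one_smul]

/-- **`V(α) = 0` off `𝔄²ʳₘ ∪ {0}`**: if `α ≠ 0` is not admissible (some `αᵢ = 0`, or `Σ αᵢ ≠ 0`) then
`dim V(α) = 0` in `H²ʳ(X²ʳₘ(ℂ); ℂ)` (`r, m ≥ 1`). [cite: Shioda1979HodgeFermat, §1 (1.3)–(1.4)] -/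
theorem finrank_fermatEigenspace_eq_zero_of_not (hm : 1 ≤ m) {r : ℕ} (hr : 1 ≤ r)
    {α : Fin (2 * r + 2) → ZMod m} (hα0 : α ≠ 0) (hα : ¬ ((∀ i, α i ≠ 0) ∧ ∑ i, α i = 0)) :
    Module.finrank ℂ ↥(fermatEigenspace m α (2 * r)) = 0 := by
  haveI : NeZero m := ⟨by omega⟩
  have hbot : fermatEigenspace m α (2 * r) = ⊥ := by
    rw [not_and_or] at hα
    rcases hα with h1 | h2
    · push Not at h1
      obtain ⟨i, hi⟩ := h1
      exact fermatEigenspace_eq_bot_of_apply_eq_zero hm hr hα0 hi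
    · exact fermatEigenspace_eq_bot_of_sum_ne_zero h2 _
  rw [hbot, finrank_bot]

/-- **The middle Betti number of the even-dimensional Fermat variety: `b₂ᵣ(X²ʳₘ) = |𝔄²ʳₘ| + 1`** (`r, m ≥ 1`),
`𝔄²ʳₘ = {α ∈ (ℤ/m ∖ 0)^{2r+2} : Σ αᵢ = 0}`: the character decomposition `H²ʳ = ⊕_α V(α)` with `dim V(α) = 1` on
`𝔄²ʳₘ ∪ {0}` and `0` elsewhere. [cite: Shioda1979HodgeFermat, §1 (1.3)–(1.4)] [cite: Ran1980, §1 Prop. 1.7 (i)] -/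
theorem finrank_complexBetti_fermat_even_eq_card_add_one [NeZero m] {r : ℕ} (hr : 1 ≤ r) :
    Module.finrank ℂ (complexBetti (fermatHypersurface (2 * r) m) (2 * r)) =
      Fintype.card {α : Fin (2 * r + 2) → ZMod m // (∀ i, α i ≠ 0) ∧ ∑ i, α i = 0} + 1 := by
  classical
  have hm : 1 ≤ m := NeZero.one_le
  have hX : IsSmoothProjective (2 * r) (fermatHypersurface (2 * r) m) :=
    isSmoothProjective_fermatHypersurface (by omega) hm
  haveI := finite_complexBetti hX (2 * r)
  set V : (Fin (2 * r + 2) → ZMod m) → Submodule ℂ (complexBetti (fermatHypersurface (2 * r) m) (2 * r)) :=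
    fun α ↦ fermatEigenspace m α (2 * r) with hV
  have hind : iSupIndep V := iSupIndep_fermatEigenspace (n := 2 * r) (m := m) (2 * r)
  have htop : ⨆ α, V α = ⊤ := iSup_fermatEigenspace_eq_top (n := 2 * r) (m := m) (2 * r)
  -- the dimension of each `V(α)` as an indicator
  have hdim : ∀ α, Module.finrank ℂ ↥(V α) = if ((∀ i, α i ≠ 0) ∧ ∑ i, α i = 0) ∨ α = 0 then 1 else 0 := by
    intro α
    by_cases hgood : (∀ i, α i ≠ 0) ∧ ∑ i, α i = 0
    · rw [if_pos (Or.inl hgood)]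
      exact finrank_fermatEigenspace_eq_one_of_forall_ne_zero hr hgood.1 hgood.2
    · by_cases h0 : α = 0
      · rw [if_pos (Or.inr h0), h0]
        exact finrank_fermatEigenspace_zero_eq_one hm hr
      · rw [if_neg (by tauto)]
        exact finrank_fermatEigenspace_eq_zero_of_not hm hr h0 hgood
  calc Module.finrank ℂ (complexBetti (fermatHypersurface (2 * r) m) (2 * r))
      = Module.finrank ℂ (⊤ : Submodule ℂ (complexBetti (fermatHypersurface (2 * r) m) (2 * r))) :=
        (finrank_top ℂ _).symm
    _ = Module.finrank ℂ ↥(⨆ α, V α) := by rw [htop]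
    _ = ∑ α, Module.finrank ℂ ↥(V α) := finrank_iSup_eq_sum_of_iSupIndep V hind
    _ = ∑ α, (if ((∀ i, α i ≠ 0) ∧ ∑ i, α i = 0) ∨ α = 0 then 1 else 0) := Finset.sum_congr rfl fun α _ ↦ hdim α
    _ = Fintype.card {α : Fin (2 * r + 2) → ZMod m // ((∀ i, α i ≠ 0) ∧ ∑ i, α i = 0) ∨ α = 0} := by
        rw [Finset.sum_boole, Fintype.card_subtype]
        rfl
    _ = Fintype.card {α : Fin (2 * r + 2) → ZMod m // (∀ i, α i ≠ 0) ∧ ∑ i, α i = 0} + 1 := by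
        rw [Fintype.card_subtype_or_disjoint]
        · rw [Fintype.card_subtype_eq]
        · rw [Pi.disjoint_iff]
          intro α
          rw [Prop.disjoint_iff]
          rintro ⟨hgood, h0⟩
          exact hgood.1 0 (by rw [h0]; rfl)

/-- **`b₂(X²ₘ) = m³ − 4m² + 6m − 2` for the Fermat surface `X²ₘ ⊂ ℙ³`** (`m ≥ 1`; over `ℂ`), written
`m³ + 6m − (4m² + 2)` (no truncated subtraction for `m ≥ 1`): `|𝔄²ₘ| + 1` with
`|𝔄²ₘ| = (m − 1)(m² − 3m + 3)`. This is the Fermat value of the second Betti number of a smooth degree-`m` surface in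
`ℙ³`. [cite: Shioda1979HodgeFermat, §1 (1.3)–(1.4)] [cite: EisenbudHarris2016, Example 5.24 and Table 5.1] -/
theorem finrank_complexBetti_fermatSurface_two [NeZero m] :
    Module.finrank ℂ (complexBetti (fermatHypersurface 2 m) 2) = m ^ 3 + 6 * m - (4 * m ^ 2 + 2) := by
  have h := finrank_complexBetti_fermat_even_eq_card_add_one (m := m) (r := 1) le_rfl
  have hN := card_fermatAdmissible_four_add m
  obtain ⟨t, rfl⟩ : ∃ t, m = t + 1 := ⟨m - 1, by have := NeZero.one_le (n := m); omega⟩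
  simp only [Nat.add_sub_cancel] at hN
  change Module.finrank ℂ (complexBetti (fermatHypersurface 2 (t + 1)) 2) =
    Fintype.card {α : Fin 4 → ZMod (t + 1) // (∀ i, α i ≠ 0) ∧ ∑ i, α i = 0} + 1 at h
  rw [h]
  have h3 := card_fermatAdmissible_three_add (t + 1)
  simp only [Nat.add_sub_cancel] at h3
  have h4 := card_fermatAdmissible_succ_add (t + 1) 3
  simp only [Nat.add_sub_cancel] at h4
  set N₄ := Fintype.card {α : Fin 4 → ZMod (t + 1) // (∀ i, α i ≠ 0) ∧ ∑ i, α i = 0}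
  set N₃ := Fintype.card {α : Fin 3 → ZMod (t + 1) // (∀ i, α i ≠ 0) ∧ ∑ i, α i = 0}
  have key : N₄ + 1 + (4 * (t + 1) ^ 2 + 2) = (t + 1) ^ 3 + 6 * (t + 1) := by nlinarith [h3, h4]
  omega

/-- **`b₂(X²ₘ) = m³ − 4m² + 6m − 2` over `ℚ`** (`m ≥ 1`): `dim_ℚ H²(X²ₘ(ℂ); ℚ) = dim_ℂ H²(X²ₘ(ℂ); ℂ)` (universal
coefficients, `finrank_complexBetti_eq_finrank_bettiCohomology`). [cite: Shioda1979HodgeFermat, §1 (1.3)–(1.4)]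
[cite: EisenbudHarris2016, Example 5.24 and Table 5.1] -/
theorem finrank_bettiCohomology_fermatSurface_two [NeZero m] :
    Module.finrank ℚ (bettiCohomology (fermatHypersurface 2 m) 2) = m ^ 3 + 6 * m - (4 * m ^ 2 + 2) := by
  rw [← finrank_complexBetti_fermatSurface_two]
  change Module.finrank ℚ (singularCohomology ℚ ℚ (ComplexPoints (fermatHypersurface 2 m)) 2) =
    Module.finrank ℂ (singularCohomology ℂ ℂ (ComplexPoints (fermatHypersurface 2 m)) 2)
  rw [finrank_singularCohomology_eq_bettiNumber_of_field, finrank_singularCohomology_eq_bettiNumber_of_field,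
    bettiNumber_eq_of_algebra ℚ ℂ]

end Fermat

end Literature.AlgebraicGeometry.HodgeTheory

end
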